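import Summits.ResolutionOfSingularities.ResolutionOfSingularities.Theorems.FrobeniusClosingPatchingRelPerfectCoreRungSquarePlusLinearCharts
import HarnessLib

/-!
# Crux `PatchingRelPerfect` (stmt-ResolutionOfSingularities-16161), chain w52 — CORE RUNG r1c:
# the blow-up-form open core on the family `I = 𝔪² + (z₁, …, z_m)`, `z` part of a regular
# system of parameters (the first rung where the COMPANION is exercised)

[OURS · L1 W5.2 · rung] The open core of the registered skeleton v5.1 of the line
`closed-point-slice` is `stub_atomDimFourBlowup` (`AtomDimFourBlowupAt p`): for `S` complete
regular local of dimension `4`, characteristic `p`, perfect residue field, `I ≠ 0` an ideal and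
`T = Bl_I Spec S` regular off the closed fibre, a non-zero fibre-cosupported ideal sheaf `J` on `T`
with REGULAR blowing up.  In companion language (W2, `atomConclusion_of_companion_regularLocal`,
Stacks 080A) a non-zero `𝔪`-cosupported `Q` with `Bl_{I·Q} Spec S` regular suffices.  CHAIN.md v1
§1 (A) asks for RUNGS = the core restricted to named families of ideals; r0 (stub-1, p465206:
`I = 𝔪ᵈ`, `I` principal) and r1a (stub-3: `I · 𝔪ᴺ = 𝔪ᵈ`) have `Bl_{I·Q} ≅ Bl_𝔪`.

This file lands rung **r1c: `I = 𝔪² + (z₁, …, z_m)` for `z` part of a regular system of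
parameters of `S`** (coordinate-free: `𝔪² + 𝔞` with `𝔞` generated by part of a minimal basis of
`𝔪`, i.e. the square of the maximal ideal enlarged by the ideal of a regular germ `Z = V(z)`
through the closed point; `m = 0` and `m = dim S` are r0's `𝔪²` and `𝔪`).  Here `T = Bl_I Spec S`
is itself SINGULAR for `0 < m < dim S` (on the chart of a tangent direction `y` of `Z` it is
`{y · w = z_j…}`-shaped: transversal `A₁`-singularities along an `(n-2)`-fold over the closed
point), so a companion is genuinely needed: **`Q = 𝔪` works**, because
`Bl_{I·𝔪} Spec S = Bl_{I·𝒪_B} B`, `B = Bl_𝔪 Spec S` (Stacks 080A), and on the Rees chart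
`D₊(x_i t) = Spec (S[𝔪t])_{(x_i t)}` of `B` the total transform `I · B_i` is
* `(z_j)` — the exceptional divisor, invertible — if `x_i = z_j` is a killed direction
  (`map_chartBase_sqSup_castAdd`);
* `y_k · (y_k, z₁/y_k, …, z_m/y_k)` if `x_i = y_k` is a tangent direction of `Z`
  (`map_chartBase_sqSup_natAdd`): the exceptional parameter times the ideal of the REGULAR centre
  `ℙ(T_Z) ⊆ E ≅ ℙ^{n-1}` (`B_i ⧸ (y_k, z/y_k) ≅ κ[T]`, de Jong's chart computation
  `isRegularRing_quot_chartIdeal` of `BlowupChartRsop.lean`),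
so chart by chart the blow-up along `I · B_i` is the blow-up of a regular scheme along a regular
centre twisted by an effective Cartier divisor (`IsBlowup.mul_of_isEffectiveCartier`), regular by
Liu 8.1.19 (a) (`IsBlowup.isRegular_of_isRegular_subscheme`); the charts are reached from a global
blow-up of `B` by FLAT base change along the chart immersions (`IsBlowup.pullback_snd_of_flat`).
Geometrically: blow up the closed point, then the projectivised tangent space of `Z` inside the
exceptional divisor.

Everything holds in EVERY dimension and for EVERY regular local base `S` (no completeness,
characteristic, residue-field or dimension hypothesis); the atom's hypothesis "regular off the
closed fibre" is automatic (`𝔪² ⊆ I`).  In dimension `4` the family is, up to the choice of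
parameters, `(x₁,…,x₄)² + (x₁, …, x_m)`, e.g. `(x₁², x₂, x₃, x₄)` (`m = 3`) and
`(x₁², x₁x₂, x₂², x₃, x₄)` (`m = 2`).  BC5-type FORMAT evidence for the core (tri-1 calibration
(3): rungs are format evidence, not standing) on an `𝔪`-primary stratum where `Bl_I` is singular
— the first rung in which the companion language of W2 is actually exercised.  NOT covered: general
`𝔪`-primary monomial ideals (r1, stub-2: toric fan regularity), `𝔪ᵏ + (z)` for `k ≥ 3` (needs
`k - 1` successive point blow-ups), the squarefree Veronese ideal (r2).  Nothing here is a
statement of the manuscript under review.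

Results: `isRegular_subscheme_idealSheaf_of_quotient`, `isRegular_of_isBlowup_idealSheaf_of_quotient`,
`isRegular_of_isBlowup_idealSheaf_span_singleton_mul`,
`isRegular_of_isBlowup_idealSheaf_span_singleton_of_isRegularRing` (affine regular-centre tools);
`map_chartBase_sqSup_natAdd`, `map_chartBase_sqSup_castAdd` (the total transform on the Rees
charts); `isRegularRing_chartRing_rsop`, `isRegularRing_chartRing_quot_natAdd`,
`isRegular_of_isBlowup_chart(_natAdd|_castAdd)`, `isRegular_of_isBlowup_comap_pointBlowup`
(assembly: a blow-up of `Bl_𝔪 Spec S` is regular as soon as its flat pullbacks to the Rees charts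
are), `isRegular_of_isBlowup_sqSup_mul_maximal` (`Bl_{I·𝔪}` regular); the rungs
`coreRung_sqSup_rsop` (coordinates), `coreRung_sq_maximalIdeal_sup_rsopPart` (coordinate-free,
`IsRsopPart z`), `atomDimFourBlowupAt_sq_maximalIdeal_sup_rsopPart` (the registered core's binder
shape, restricted to the family).

## References

* The Stacks Project, Tags 080A, 080B, 0804, 0BIQ. [StacksProject]
* Q. Liu, *Algebraic Geometry and Arithmetic Curves*, OUP 2002, Thm. 8.1.19 (a)–(b). [Liu2002]
* U. Görtz, T. Wedhorn, *Algebraic Geometry I* (2nd ed., 2020), Prop. 13.91 (2), (13.19) p. 413.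
  [GortzWedhorn2020]
* A. J. de Jong, *Smoothness, semi-stability and alterations*, Publ. Math. IHÉS 83 (1996), 2.4.
  [DeJong1996]
* H. Matsumura, *Commutative Ring Theory*, CUP 1986, Thms. 14.2, 16.2, 19.3. [Matsumura1987]
-/

-- `Summit.<Summit>.<Sub>.Theorems` with `Sub = Summit` (single-conjunct summit, D-0017)
set_option linter.dupNamespace false

noncomputable section

open CategoryTheory CategoryTheory.Limits AlgebraicGeometry Literature.AlgebraicGeometry.Resolution
open Summit.ResolutionOfSingularities.ResolutionOfSingularities.Theorems.PatchingRelPerfect.Negative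
  (isBlowup_ne_bot_of_nonempty)

namespace Summit.ResolutionOfSingularities.ResolutionOfSingularities.Theorems

universe u

/-! ## Regularity of `Bl_{I·𝔪} Spec S` and the rung -/

section Assembly

variable {S : Type u} [CommRing S] [IsRegularLocalRing S] {m e : ℕ} (x : Fin (m + e) → S)
  (hx : Ideal.span (Set.range x) = IsLocalRing.maximalIdeal S)
  (hd : (IsLocalRing.maximalIdeal S).spanFinrank = m + e)

local notation3 "M" => Ideal.span (Set.range x)
local notation3 "Isq" => Ideal.span (Set.range x) ^ 2 ⊔
  Ideal.span (Set.range fun j : Fin m => x (Fin.castAdd e j))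

include hx hd in
/-- **Assembly over the charts**: every blow-up of `B = Bl_𝔪 Spec S = Proj S[𝔪t]` along the total
transform `I · 𝒪_B` is regular — its flat pullbacks to the Rees charts `D₊(x_i t)` (which cover `B`)
are blow-ups of the charts along `I · B_i` (blow-ups commute with flat base change), regular by
the chart statements. [cite: GortzWedhorn2020, Prop. 13.91 (2)] [cite: Liu2002, Thm. 8.1.19 (a)] -/
theorem isRegular_of_isBlowup_comap_pointBlowup {Y : Scheme.{u}}
    {ρ : Y ⟶ affineBlowup (Ideal.span (Set.range x))}
    (hρ : IsBlowup ρ ((affineBlowup.idealSheaf (Isq)).comap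
      (affineBlowup.π (Ideal.span (Set.range x))))) :
    Scheme.IsRegular Y := by
  refine Scheme.IsRegular.of_forall_exists_isOpenImmersion fun y => ?_
  have hp : ρ.base y ∈ (⨆ i : Fin (m + e), Proj.basicOpen (reesGrading M)
      (reesT (x i) (Ideal.mem_span_range_self (f := x) (x := i)))) := by
    rw [affineBlowup.iSup_basicOpen_reesT_generators_eq_top x]; trivial
  obtain ⟨i, hi⟩ := TopologicalSpace.Opens.mem_iSup.mp hp
  have hb : x i ∈ M := Ideal.mem_span_range_self (f := x) (x := i)
  have hrange : ρ.base y ∈ Set.range (affineBlowup.chartι (I := M) (x i) hb).base := by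
    rw [← Scheme.Hom.coe_opensRange, ← Scheme.Hom.image_top_eq_opensRange,
      affineBlowup.image_top_chartι]
    exact hi
  -- the flat pullback of `ρ` to the chart is a blow-up of the chart along `I · B_i`
  have hsnd : IsBlowup (pullback.snd ρ (affineBlowup.chartι (I := M) (x i) hb))
      (affineBlowup.idealSheaf ((Isq).map (chartBase x i))) := by
    have h := hρ.pullback_snd_of_flat (affineBlowup.chartι (I := M) (x i) hb)
    rwa [← Scheme.IdealSheafData.comap_comp, affineBlowup.chartι_π,
      affineBlowup.comap_idealSheaf_specMap] at h
  have hreg := isRegular_of_isBlowup_chart x hx hd i hsnd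
  refine ⟨_, pullback.fst ρ (affineBlowup.chartι (I := M) (x i) hb), inferInstance, ?_, hreg⟩
  rw [Scheme.Pullback.range_fst]
  exact hrange

include hx hd in
/-- **`Bl_{I·𝔪} Spec S` is regular** for `I = 𝔪² + (z)`: it is `Bl_𝔪` followed by the blow-up of
the total transform of `I` (Stacks 080A), regular by the assembly over the charts.
[cite: StacksProject, Tag 080A] [cite: Liu2002, Thm. 8.1.19 (a)] -/
theorem isRegular_of_isBlowup_sqSup_mul_maximal {Y : Scheme.{u}} {σ : Y ⟶ Spec (.of S)}
    (hσ : IsBlowup σ (affineBlowup.idealSheaf ((Isq) * Ideal.span (Set.range x)))) :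
    Scheme.IsRegular Y := by
  obtain ⟨Y₁, ρ, hρ⟩ := exists_isBlowup (affineBlowup M)
    ((affineBlowup.idealSheaf (Isq)).comap (affineBlowup.π M))
  have h1 : IsBlowup (ρ ≫ affineBlowup.π M) (affineBlowup.idealSheaf ((Isq) * M)) := by
    rw [mul_comm, affineBlowup.idealSheaf_mul]
    exact (affineBlowup.isBlowup M).comp hρ
  obtain ⟨e, -, -⟩ := hσ.unique h1
  exact SectionAscent.TraceIdeal.isRegular_of_iso e
    (isRegular_of_isBlowup_comap_pointBlowup x hx hd hρ)

include hx hd in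
/-- **CORE RUNG r1c in coordinates.** For a regular local `S` with regular system of parameters
`x = (z₁, …, z_m, y₁, …, y_e)` and `I = 𝔪² + (z₁, …, z_m) ≠ 0`, every blow-up `T = Bl_I Spec S`
satisfies the conclusion of the blow-up-form core `AtomDimFourBlowupAt`: the companion `Q = 𝔪`
works (`Bl_{I·𝔪}` is regular), so `J = 𝔪 · 𝒪_T` is a non-zero ideal sheaf cosupported in the
closed fibre with regular blowing up (W2, `atomConclusion_of_companion_regularLocal`). Every
dimension, every regular local base; no completeness, characteristic or residue-field hypothesis.
[cite: StacksProject, Tag 080A] [cite: Liu2002, Thm. 8.1.19 (a)] -/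
theorem coreRung_sqSup_rsop (hI : (Isq) ≠ ⊥) (T : Scheme.{u}) (f : T ⟶ Spec (.of S))
    (hf : IsBlowup f (affineBlowup.idealSheaf (Isq))) :
    ∃ (J : T.IdealSheafData) (T' : Scheme.{u}) (π : T' ⟶ T), J ≠ ⊥ ∧
      (∀ t : T, t ∈ J.support → f.base t = IsLocalRing.closedPoint S) ∧
      IsBlowup π J ∧ Scheme.IsRegular T' := by
  -- the companion `Q = 𝔪`: `Bl_{I·𝔪} Spec S` is regular
  obtain ⟨Y, σ, hσ⟩ := exists_isBlowup (Spec (.of S)) (affineBlowup.idealSheaf ((Isq) * M))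
  have hY := isRegular_of_isBlowup_sqSup_mul_maximal x hx hd hσ
  rw [affineBlowup.idealSheaf_mul] at hσ
  have hle : (Isq) ≤ M :=
    sup_le (Ideal.pow_le_self two_ne_zero) (Ideal.span_mono (by rintro _ ⟨j, rfl⟩; exact ⟨_, rfl⟩))
  have hM : (M) ≠ ⊥ := fun h => hI (eq_bot_iff.mpr (hle.trans h.le))
  have hsupp : IsLocalRing.maximalIdeal S ^ 1 ≤ M := by rw [pow_one, hx]
  exact atomConclusion_of_companion_regularLocal hf (affineBlowup.idealSheaf_ne_bot hI)
    (affineBlowup.idealSheaf_ne_bot hM) (support_idealSheaf_subset_closedPoint hsupp) hσ hY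

end Assembly

/-! ## The rung, coordinate-free -/

/-- **CORE RUNG r1c: the blow-up-form open core on the family `I = 𝔪² + (z₁, …, z_m)`, `z` part of
a regular system of parameters** (equivalently `𝔪² + 𝔞` with `S ⧸ 𝔞` regular and `𝔞` generated by
part of a minimal basis of `𝔪`; `m = 0`: `I = 𝔪²`, `m = dim S`: `I = 𝔪`, rung r0). For `S` regular
local of any dimension and `T = Bl_I Spec S` ANY blow-up along `I ≠ 0` — a SINGULAR scheme for
`0 < m < dim S` (transversal `A₁`-singularities along an `(n - 2)`-fold over the closed point) —
there is a non-zero ideal sheaf `J` on `T` cosupported in the closed fibre with regular blowing up: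
the companion `Q = 𝔪` of W2 works, `Bl_{I·𝔪} Spec S` being `Bl_𝔪 Spec S` followed by the blow-up
of the REGULAR centre `ℙ(T_Z) ⊆ E ≅ ℙ^{n-1}`, `Z = V(z)`. Restricted to `dim S = 4`, `S` complete
of characteristic `p` with perfect residue field, this is the registered open core
`stub_atomDimFourBlowup` (`AtomDimFourBlowupAt p`) of skeleton v5.1 on this family, its hypothesis
"regular off the closed fibre" being automatic (`𝔪² ⊆ I`). BC5-type FORMAT evidence for the core on
a non-toric-looking 𝔪-primary stratum where `Bl_I` itself is singular; the first rung in which the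
companion language (W2) is exercised. Nothing here is a statement of the manuscript under review.
[cite: StacksProject, Tag 080A] [cite: Liu2002, Thm. 8.1.19 (a)] -/
theorem coreRung_sq_maximalIdeal_sup_rsopPart {S : Type u} [CommRing S] [IsRegularLocalRing S]
    {m : ℕ} {z : Fin m → S} (hz : IsRsopPart z)
    (hI : IsLocalRing.maximalIdeal S ^ 2 ⊔ Ideal.span (Set.range z) ≠ ⊥)
    (T : Scheme.{u}) (f : T ⟶ Spec (.of S))
    (hf : IsBlowup f (affineBlowup.idealSheaf
      (IsLocalRing.maximalIdeal S ^ 2 ⊔ Ideal.span (Set.range z)))) :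
    ∃ (J : T.IdealSheafData) (T' : Scheme.{u}) (π : T' ⟶ T), J ≠ ⊥ ∧
      (∀ t : T, t ∈ J.support → f.base t = IsLocalRing.closedPoint S) ∧
      IsBlowup π J ∧ Scheme.IsRegular T' := by
  obtain ⟨e, x, hd, hx, hxz⟩ := hz.exists_rsop
  have hzx : (fun j : Fin m => x (Fin.castAdd e j)) = z := funext hxz
  subst hzx
  rw [← hx] at hI hf
  exact coreRung_sqSup_rsop x hx hd hI T f hf


/-- **The registered core's binder shape, restricted to the family.** With exactly the hypotheses
of `stub_atomDimFourBlowup` (`hA4B` of the certificate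
`patchingRelPerfect_of_printed_of_atomDimFourBlowup_of_residualStrata`: `S` regular local of
characteristic `p`, `𝔪`-adically complete, perfect residue field, `dim S = 4`; `I ≠ 0`; `T` a
blow-up of `Spec S` along `I`, regular off the closed fibre) and `I = 𝔪² + (z₁, …, z_m)` for a part
`z` of a regular system of parameters, the core's conclusion holds. The dimension, characteristic,
completeness, residue-field and off-fibre hypotheses are not used (underscored).
[cite: StacksProject, Tag 080A] [cite: Liu2002, Thm. 8.1.19 (a)] -/
theorem atomDimFourBlowupAt_sq_maximalIdeal_sup_rsopPart (p : ℕ) (_hp : p.Prime) (S : Type)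
    [CommRing S] [IsRegularLocalRing S] [CharP S p]
    [IsAdicComplete (IsLocalRing.maximalIdeal S) S]
    [PerfectField (IsLocalRing.ResidueField S)] (_hS : ringKrullDim S = (4 : ℕ))
    {m : ℕ} {z : Fin m → S} (hz : IsRsopPart z)
    (hI : IsLocalRing.maximalIdeal S ^ 2 ⊔ Ideal.span (Set.range z) ≠ ⊥)
    (T : Scheme.{0}) (f : T ⟶ Spec (.of S))
    (hf : IsBlowup f (affineBlowup.idealSheaf
      (IsLocalRing.maximalIdeal S ^ 2 ⊔ Ideal.span (Set.range z))))
    (_hoff : ∀ t : T, f.base t ≠ IsLocalRing.closedPoint S →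
      IsRegularLocalRing (T.presheaf.stalk t)) :
    ∃ (J : T.IdealSheafData) (T' : Scheme.{0}) (π : T' ⟶ T), J ≠ ⊥ ∧
      (∀ t : T, t ∈ J.support → f.base t = IsLocalRing.closedPoint S) ∧
      IsBlowup π J ∧ Scheme.IsRegular T' :=
  coreRung_sq_maximalIdeal_sup_rsopPart hz hI T f hf

/-- **In positive dimension the non-vanishing hypothesis is automatic**: `𝔪² + (z) ≠ 0` as soon
as `𝔪 ≠ 0` (a regular local ring is a domain). [folklore] -/
theorem sq_maximalIdeal_sup_ne_bot {S : Type u} [CommRing S] [IsRegularLocalRing S]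
    (h𝔪 : IsLocalRing.maximalIdeal S ≠ ⊥) (𝔞 : Ideal S) :
    IsLocalRing.maximalIdeal S ^ 2 ⊔ 𝔞 ≠ ⊥ := by
  haveI : IsDomain S := isDomain_of_isRegularLocalRing S
  intro h
  exact pow_ne_zero 2 h𝔪 (eq_bot_iff.mpr (le_sup_left.trans h.le))

end Summit.ResolutionOfSingularities.ResolutionOfSingularities.Theorems

end
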